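/-
Copyright (c) 2026 the pub-hodgecm-mathlib formalisation cell (harness21).  Prover seat hodgecm-mathlib-R90-C14-p02 (g3) (section S6, dealer R90-C14-plan (g3),
card (R84) FILE 4 «(U1) ⟸ the four per-literal V₁ letters», R90 bus 2026-09-05T04:07:54Z; census `R90/R90-C14-p02/g3/FILE4-CENSUS.md` b386ab2d).  FILE 4a = regime
`a ≡ b` (pairing R-IIab) IN VALUES.  THEOREMS ONLY (no `def`, no `instance`, no notation, no named-fact hypothesis, no `sorry`); lane `--supports stmt-HodgeConjecture-24833
--as helper` (count-neutral helper).
-/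
import Summits.HodgeConjecture.HodgeConjecture.Theorems.R90S6EllipticIdentityTypeOneUnitLevel            -- ★ FILE 3b p865360 (this seat): (E1) ⟸ (U1); brings ★ 3a, ★ 1b
import Summits.HodgeConjecture.HodgeConjecture.Theorems.R90S6EllipticIdentityTypeOneSeparated            -- ★ FILE 2 p865333 (this seat): `finite_quotient_glInt_inf_conj_glInt`
import Summits.HodgeConjecture.HodgeConjecture.Theorems.R90S6TorusFixedSpecialCountTwoCongruentFlicker  -- ★ R2M F2 (p05): the four special counts (3a)–(3d) in regime `a ≡ b`
import HarnessLib

/-!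
# R90 · S6 — CARD (R84) FILE 4a: THE TYPE-(1) ELLIPTIC κ-IDENTITY (E1) IN THE TWO-CONGRUENT REGIME `a ≡ b` (`|a−b| = |ϖⁿ|`, `n ≥ 1`, `|a−c| = 1`), FOR EVERY `m`
# (`Theorems/R90S6EllipticIdentityTypeOneCongruentAB.lean`)

Cell `hodgecm-mathlib`, crux H413 (`stmt-HodgeConjecture-24833`), route of record `HCCMUnconditional`; programme R90-TF, section S6 (base `R90-C14`), seat
R90-C14-p02 (g3); card (R84) (dealer R90-C14-plan (g3), RULINGS #37 04:07:54Z), census `FILE4-CENSUS.md` b386ab2d (regime table).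
Target of record = typ1 (g3)'s (E1) `delta_mul_kappaSum_ncard_displaced_flicker_eq_sum_xiHCoeff_mul_ncard_displaced_two` (sheet v2.3 `4c174fca74d7a58a` :191).

THE MATHEMATICS.  Regime R-IIab: `a ≡ b` to depth `n ≥ 1` (`|a − b| = |ϖⁿ|`) and `c` residually separated (`|a − c| = 1`, hence `|b − c| = 1`); so `N = ord(a−c) = 0`,
`N₁ = ord(a−b) = n`, `N₂ = ord(c−b) = 0`, `Δ = ((−q)^n)⁻¹`, `Φ = #Fix(δ₁) = φ_H(q, 0) = 1`.  The SPECIAL fixed counts of the four Flicker literals are ★ R2M F2 (p05):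
`V₁(t_1(a,b,c)) = 1 + q·φ₀(n−1,0,0)`, `V₁(t_ϖ(a,b,c)) = 1`, `V₁(t_ϖ(a,c,b)) = 1 + q·φ₁(0,n−1)`, `V₁(t_ϖ(b,a,c)) = 1`, whence `Σ±V₁ = q·(φ₀(n−1,0,0) − φ₁(0,n−1)) =
q·φ_κ(q; n−1, 0, 0) = q·(−q)^{n−1}·φ_H(q,0) = −(−q)ⁿ` (★ FLICKER THEOREM 15 at the SHIFTED exponents `(n−1, 0, 0)`), i.e. **(U1) `Δ·Σ±V₁ = −1 = Φ − 2`** — the special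
level is the unit fundamental lemma ONE LEVEL DOWN (Kottwitz's shift).  With ★ FILE 3b ((U0) in every regime, (E1) ⟸ (U1)): **(E1) at every `m`, unconditionally, in regime
`a ≡ b`** (after R-III = ★ FILE 2, the second fully ★ stratum of row E1.3.5.2.6 type (1)).  The instance letters of ★ F2 are BUILT as in ★ FILE 2 (`Fintype` from `hfin₀ᵢ`,
`r = Quotient.out`, `Finite (K₀ ⧸ (K₀ ⊓ K₁))`); the non-dyadic datum from ★ 3a `localConjDatum_of_isAdicComplete`.
* §1 `kappaSum_natCard_fixedBy_special_eq_of_congruent_ab` — (U1) in values (ℂ); §2 HEAD **`delta_mul_kappaSum_ncard_displaced_flicker_eq_sum_xiHCoeff_mul_ncard_displaced_two_of_congruent_ab`**: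
  (E1)'s conclusion BYTES VERBATIM for every `m` under (E1) v2.3's letters (minus `hσe hab hbc hac`) + the regime letters `hn : 1 ≤ n`, `hab : |a−b| = |ϖⁿ|`, `hac : |a−c| = 1`
  (★ F2's spelling).
HONEST LABEL: the regime `a ≡ b` only; regimes `a ≡ c`, `b ≡ c` wait on three F2-twins ((M-a)(M-b)(M-c) of the census: congruent line eigenvalue in the plane's z-slot; θ = 1
plane-congruent), regime R-I on the unipotent values; count-neutral until E1.3.9 consumes (E1).  HC_CM is proved only modulo the 7 printed citations (2 remaining named inputs:
hLiu418 = stmt-HodgeConjecture-24832, h413 = stmt-HodgeConjecture-24833) until rung 0 closes; REL ≠ ★ ≠ BUILT.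

## References
* [Flicker1998UnitaryFL] Y. Z. Flicker, *Elementary proof of the fundamental lemma for a unitary group*, Canad. J. Math. 50 (1998): Prop. 11 p. 87, Prop. 14 p. 94,
  §6 Theorem 15 pp. 95–96.
* [Kottwitz1986BaseChangeUnits] R. E. Kottwitz, *Base change for unit elements of Hecke algebras*, Compositio Math. 60 (1986), §1 pp. 240–241, §3.
* [Rogawski1990] J. D. Rogawski, *Automorphic Representations of Unitary Groups in Three Variables*, Ann. of Math. Stud. 123 (1990): §4.9 Prop. 4.9.1 (b) pp. 54–55.
* [LabesseLanglands1979] J.-P. Labesse, R. P. Langlands, *L-indistinguishability for SL(2)*, Canad. J. Math. 31 (1979), §§2–3.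
-/

set_option autoImplicit false
-- the mandated namespace repeats the single-problem summit's segment (`HodgeConjecture.HodgeConjecture`)
set_option linter.dupNamespace false

noncomputable section

open MulAction SimpleGraph Finset
open scoped Valued WithZero Matrix MatrixGroups
open Literature.NumberTheory.Automorphic Literature.NumberTheory.Automorphic.HermitianLattice Literature.NumberTheory.Automorphic.UnitaryGroup
open Literature.NumberTheory.Rogawski1990.Flicker1998 (phiZero phiOne phiH phiKappa flicker_theorem15)
open Literature.Combinatorics.SimpleGraph

namespace Summit.HodgeConjecture.HodgeConjecture.R90.S6

section CongruentAB

/-! ## §1 (U1) in regime `a ≡ b`: `Δ·(V₁₁ + V₁₂ − V₁₃ − V₁₄) = Φ − 2` -/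

-- ★ R2M F2's quotient-action instances and the four `Fintype ↥(fixedBy …)` instances exceed the default synthesis budget (same bump as ★ F2 ∕ ★ counts B)
set_option synthInstance.maxHeartbeats 400000 in
set_option maxHeartbeats 1600000 in
/-- **(U1) IN REGIME `a ≡ b` — THE SPECIAL-LEVEL UNIT IDENTITY.**  Under typ1's (E1) v2.3 letters (datum, residual letters, `|2| = 1`, `2e = 1`, norm-one `a b c`, the four
literals, `δ₁`, the frame letters `hy ha₀` + completeness, `g₁ hg₁`, the three finiteness letters per literal, the `X₂` root ∕ regularity) and the regime letters `n ≥ 1`,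
`|a − b| = |ϖⁿ|`, `|a − c| = 1`: `(−q)^{log|(b−a)(b−c)|}·(V₁(γ₁) + V₁(γ₂) − V₁(γ₃) − V₁(γ₄)) = #Fix_{X₂}(δ₁) − 2` — ★ R2M F2 (3a)(3b)(3c)(3d) ∘ ★ `flicker_theorem15` at `(n−1, 0, 0)` ∘
★ 3a `ncard_compression_fixed_eq_phiH` (`Φ = φ_H(q,0) = 1`). [cite: Flicker1998UnitaryFL, §6 Theorem 15 pp. 95–96] [cite: Kottwitz1986BaseChangeUnits, §1 pp. 240–241, §3]
[cite: Rogawski1990, §4.9 Prop. 4.9.1 (b) pp. 54–55] -/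
theorem kappaSum_natCard_fixedBy_special_eq_of_congruent_ab
    {K : Type} [Field K] [Valued K ℤᵐ⁰] [ValuativeRel K] [(Valued.v : Valuation K ℤᵐ⁰).Compatible]
    {σ : K →+* K} {ϖ : K} (hd : HermitianLattice.UnramifiedLocalConjDatum σ ϖ)
    (hσO : ∀ x : 𝒪[K], σ x ∈ 𝒪[K]) (σk : 𝓀[K] →+* 𝓀[K])
    (hσk : ∀ x : 𝒪[K], IsLocalRing.residue 𝒪[K] ⟨σ x, hσO x⟩ = σk (IsLocalRing.residue 𝒪[K] x))
    [Fintype 𝓀[K]] {q : ℕ} (hq : Fintype.card 𝓀[K] = q ^ 2) (hfrob : ∀ y, σk y = y ^ q)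
    (h2 : Valued.v (2 : K) = 1) {e : K} (h2e : 2 * e = 1)
    {a b c : K} (ha : σ a * a = 1) (hb : σ b * b = 1) (hc : σ c * c = 1)
    -- regime R-IIab (★ R2M F2's letters): `a ≡ b` to depth `n ≥ 1`, `c` residually separated
    {n : ℕ} (hn : 1 ≤ n) (hab : Valued.v (a - b) = Valued.v (ϖ ^ n)) (hac : Valued.v (a - c) = 1)
    -- Flicker's four classes of the stable class of the `E¹`-type element with eigenvalues `(a, b, c)`, `b` on the `U(1)`-slot; κ-signs `(+,+,−,−)`
    (γ₁ γ₂ γ₃ γ₄ : unitaryGroupOfForm σ ((StdForm.antidiagonal 3).over K))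
    (hγ₁ : ((γ₁ : GL (Fin 3) K) : Matrix (Fin 3) (Fin 3) K) = !![e * (a + c), 0, -(e * (a - c)); 0, b, 0; -(e * (a - c)), 0, e * (a + c)])
    (hγ₂ : ((γ₂ : GL (Fin 3) K) : Matrix (Fin 3) (Fin 3) K) = !![e * (a + c), 0, -(e * (a - c) * ϖ); 0, b, 0; -(e * (a - c) * ϖ⁻¹), 0, e * (a + c)])
    (hγ₃ : ((γ₃ : GL (Fin 3) K) : Matrix (Fin 3) (Fin 3) K) = !![e * (a + b), 0, -(e * (a - b) * ϖ); 0, c, 0; -(e * (a - b) * ϖ⁻¹), 0, e * (a + b)])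
    (hγ₄ : ((γ₄ : GL (Fin 3) K) : Matrix (Fin 3) (Fin 3) K) = !![e * (b + c), 0, -(e * (b - c) * ϖ); 0, a, 0; -(e * (b - c) * ϖ⁻¹), 0, e * (b + c)])
    (δ₁ : unitaryGroupOfForm σ ((StdForm.antidiagonal 2).over K))
    (hδ₁ : ((δ₁ : GL (Fin 2) K) : Matrix (Fin 2) (Fin 2) K) = !![e * (a + c), -(e * (a - c)); -(e * (a - c)), e * (a + c)])
    -- frame letters used here: the DVR ∕ completeness instances (non-dyadic datum, ★ F2's CORNER engines) and `hy ha₀`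
    [IsDiscreteValuationRing 𝒪[K]] [IsAdicComplete (IsLocalRing.maximalIdeal 𝒪[K]) 𝒪[K]]
    {y : K} (hy : y * σ y = -2)
    {a₀ : 𝒪[K]} (ha₀ : IsUnit (((σ.comp 𝒪[K].subtype).codRestrict 𝒪[K] hσO) a₀ - a₀))
    (g₁ : GL (Fin 3) K) (hg₁ : (g₁ : Matrix (Fin 3) (Fin 3) K) = Matrix.diagonal ![(1 : K), 1, ϖ])
    (hfin₀₁ : (fixedBy (↥(unitaryGroupOfForm σ ((StdForm.antidiagonal 3).over K)) ⧸
      (glInt 3 K).subgroupOf (unitaryGroupOfForm σ ((StdForm.antidiagonal 3).over K))) γ₁).Finite)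
    (hfin₁₁ : (fixedBy (↥(unitaryGroupOfForm σ ((StdForm.antidiagonal 3).over K)) ⧸
      ((glInt 3 K).map (MulAut.conj g₁).toMonoidHom).subgroupOf (unitaryGroupOfForm σ ((StdForm.antidiagonal 3).over K))) γ₁).Finite)
    (horb₁ : (Set.range fun n : ℕ => ((γ₁ ^ n : ↥(unitaryGroupOfForm σ ((StdForm.antidiagonal 3).over K))) :
      ↥(unitaryGroupOfForm σ ((StdForm.antidiagonal 3).over K)) ⧸ (glInt 3 K).subgroupOf (unitaryGroupOfForm σ ((StdForm.antidiagonal 3).over K)))).Finite)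
    (hfin₀₂ : (fixedBy (↥(unitaryGroupOfForm σ ((StdForm.antidiagonal 3).over K)) ⧸
      (glInt 3 K).subgroupOf (unitaryGroupOfForm σ ((StdForm.antidiagonal 3).over K))) γ₂).Finite)
    (hfin₁₂ : (fixedBy (↥(unitaryGroupOfForm σ ((StdForm.antidiagonal 3).over K)) ⧸
      ((glInt 3 K).map (MulAut.conj g₁).toMonoidHom).subgroupOf (unitaryGroupOfForm σ ((StdForm.antidiagonal 3).over K))) γ₂).Finite)
    (horb₂ : (Set.range fun n : ℕ => ((γ₂ ^ n : ↥(unitaryGroupOfForm σ ((StdForm.antidiagonal 3).over K))) :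
      ↥(unitaryGroupOfForm σ ((StdForm.antidiagonal 3).over K)) ⧸ (glInt 3 K).subgroupOf (unitaryGroupOfForm σ ((StdForm.antidiagonal 3).over K)))).Finite)
    (hfin₀₃ : (fixedBy (↥(unitaryGroupOfForm σ ((StdForm.antidiagonal 3).over K)) ⧸
      (glInt 3 K).subgroupOf (unitaryGroupOfForm σ ((StdForm.antidiagonal 3).over K))) γ₃).Finite)
    (hfin₁₃ : (fixedBy (↥(unitaryGroupOfForm σ ((StdForm.antidiagonal 3).over K)) ⧸
      ((glInt 3 K).map (MulAut.conj g₁).toMonoidHom).subgroupOf (unitaryGroupOfForm σ ((StdForm.antidiagonal 3).over K))) γ₃).Finite)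
    (horb₃ : (Set.range fun n : ℕ => ((γ₃ ^ n : ↥(unitaryGroupOfForm σ ((StdForm.antidiagonal 3).over K))) :
      ↥(unitaryGroupOfForm σ ((StdForm.antidiagonal 3).over K)) ⧸ (glInt 3 K).subgroupOf (unitaryGroupOfForm σ ((StdForm.antidiagonal 3).over K)))).Finite)
    (hfin₀₄ : (fixedBy (↥(unitaryGroupOfForm σ ((StdForm.antidiagonal 3).over K)) ⧸
      (glInt 3 K).subgroupOf (unitaryGroupOfForm σ ((StdForm.antidiagonal 3).over K))) γ₄).Finite)
    (hfin₁₄ : (fixedBy (↥(unitaryGroupOfForm σ ((StdForm.antidiagonal 3).over K)) ⧸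
      ((glInt 3 K).map (MulAut.conj g₁).toMonoidHom).subgroupOf (unitaryGroupOfForm σ ((StdForm.antidiagonal 3).over K))) γ₄).Finite)
    (horb₄ : (Set.range fun n : ℕ => ((γ₄ ^ n : ↥(unitaryGroupOfForm σ ((StdForm.antidiagonal 3).over K))) :
      ↥(unitaryGroupOfForm σ ((StdForm.antidiagonal 3).over K)) ⧸ (glInt 3 K).subgroupOf (unitaryGroupOfForm σ ((StdForm.antidiagonal 3).over K)))).Finite)
    (x₀ : {M : Submodule (ValuativeRel.valuation K).integer (Fin 2 → K) // HermitianLatticeTree.IsSpecialLattice σ ϖ ((StdForm.antidiagonal 2).over K) M})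
    (hx₀ : x₀.1 = HermitianLatticeTree.latt (1 : Matrix (Fin 2) (Fin 2) K))
    (hloc : ∀ v, ((HermitianLatticeTree.latticeTree σ ϖ ((StdForm.antidiagonal 2).over K)).neighborSet v).Finite)
    (hreg : ∀ v, ((HermitianLatticeTree.latticeTree σ ϖ ((StdForm.antidiagonal 2).over K)).neighborSet v).ncard = q + 1) :
    (-(q : ℂ)) ^ WithZero.log (Valued.v ((b - a) * (b - c))) *
        ((Nat.card (fixedBy (↥(unitaryGroupOfForm σ ((StdForm.antidiagonal 3).over K)) ⧸
            ((glInt 3 K).map (MulAut.conj g₁).toMonoidHom).subgroupOf (unitaryGroupOfForm σ ((StdForm.antidiagonal 3).over K))) γ₁) : ℂ) +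
          (Nat.card (fixedBy (↥(unitaryGroupOfForm σ ((StdForm.antidiagonal 3).over K)) ⧸
            ((glInt 3 K).map (MulAut.conj g₁).toMonoidHom).subgroupOf (unitaryGroupOfForm σ ((StdForm.antidiagonal 3).over K))) γ₂) : ℂ) -
          (Nat.card (fixedBy (↥(unitaryGroupOfForm σ ((StdForm.antidiagonal 3).over K)) ⧸
            ((glInt 3 K).map (MulAut.conj g₁).toMonoidHom).subgroupOf (unitaryGroupOfForm σ ((StdForm.antidiagonal 3).over K))) γ₃) : ℂ) -
          (Nat.card (fixedBy (↥(unitaryGroupOfForm σ ((StdForm.antidiagonal 3).over K)) ⧸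
            ((glInt 3 K).map (MulAut.conj g₁).toMonoidHom).subgroupOf (unitaryGroupOfForm σ ((StdForm.antidiagonal 3).over K))) γ₄) : ℂ)) =
      (({v | HermitianLatticeTree.latticeTreeIso σ ϖ ((StdForm.antidiagonal 2).over K) δ₁ v = v}.ncard : ℕ) : ℂ) - 2 := by
  classical
  -- the letters ★ F2 needs beyond v2.3 (ruling (Q2)): datum, `Fintype`, the section, the star-quotient finiteness
  have hd' : LocalConjDatum σ ϖ := localConjDatum_of_isAdicComplete hd h2
  haveI := hfin₀₁.fintype
  haveI := hfin₀₂.fintype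
  haveI := hfin₀₃.fintype
  haveI := hfin₀₄.fintype
  haveI := finite_quotient_glInt_inf_conj_glInt hd hσO σk hσk hq hfrob g₁ hg₁
  have hr : Function.RightInverse
      (Quotient.out : ↥(unitaryGroupOfForm σ ((StdForm.antidiagonal 3).over K)) ⧸ (glInt 3 K).subgroupOf (unitaryGroupOfForm σ ((StdForm.antidiagonal 3).over K)) → ↥(unitaryGroupOfForm σ ((StdForm.antidiagonal 3).over K)))
      QuotientGroup.mk := fun x => QuotientGroup.out_eq' x
  have hq1 : 1 < q := by
    have h : 1 < q ^ 2 := hq ▸ Fintype.one_lt_card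
    exact (Nat.pow_lt_pow_iff_left two_ne_zero).1 (by rwa [one_pow])
  -- ★ R2M F2: the four special counts
  have hV1 := natCard_fixedBy_special_flickerOne_eq_of_two_congruent hd' hσO σk hσk hq hfrob g₁ hg₁ γ₁ hfin₁₁ horb₁ Quotient.out hr hy ha₀
    h2e ha hb hc hγ₁ hn hab hac
  have hV2 := natCard_fixedBy_special_flickerPi_abc_eq_one_of_two_congruent hd' hσO σk hσk hq hfrob g₁ hg₁ γ₂ hfin₁₂ horb₂ Quotient.out hr hy ha₀
    h2e ha hb hc hγ₂ hn hab hac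
  have hV3 := natCard_fixedBy_special_flickerPi_acb_eq_of_two_congruent hd' hσO σk hσk hq hfrob g₁ hg₁ γ₃ hfin₁₃ horb₃ Quotient.out hr hy ha₀
    h2e ha hc hγ₃ hn hab hac
  have hV4 := natCard_fixedBy_special_flickerPi_bac_eq_one_of_two_congruent hd' hσO σk hσk hq hfrob g₁ hg₁ γ₄ hfin₁₄ horb₄ Quotient.out hr hy ha₀
    h2e ha hb hc hγ₄ hn hab hac
  -- ★ FLICKER THEOREM 15 at the shifted exponents `(n−1, 0, 0)`, `φ_H(q, 0) = 1`
  have h15 := flicker_theorem15 hq1 (N₁ := n - 1) (N₂ := 0) (N := 0) (Or.inr (Or.inr ⟨rfl, Nat.zero_le _⟩))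
  have hq1' : (q : ℚ) - 1 ≠ 0 := sub_ne_zero.2 (by exact_mod_cast (ne_of_gt hq1))
  have hH0 : phiH q 0 = 1 := by
    rw [phiH, pow_zero, one_mul]
    field_simp
    ring
  have key : ((Nat.card (fixedBy (↥(unitaryGroupOfForm σ ((StdForm.antidiagonal 3).over K)) ⧸
        ((glInt 3 K).map (MulAut.conj g₁).toMonoidHom).subgroupOf (unitaryGroupOfForm σ ((StdForm.antidiagonal 3).over K))) γ₁) : ℚ) +
      (Nat.card (fixedBy (↥(unitaryGroupOfForm σ ((StdForm.antidiagonal 3).over K)) ⧸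
        ((glInt 3 K).map (MulAut.conj g₁).toMonoidHom).subgroupOf (unitaryGroupOfForm σ ((StdForm.antidiagonal 3).over K))) γ₂) : ℚ) -
      (Nat.card (fixedBy (↥(unitaryGroupOfForm σ ((StdForm.antidiagonal 3).over K)) ⧸
        ((glInt 3 K).map (MulAut.conj g₁).toMonoidHom).subgroupOf (unitaryGroupOfForm σ ((StdForm.antidiagonal 3).over K))) γ₃) : ℚ) -
      (Nat.card (fixedBy (↥(unitaryGroupOfForm σ ((StdForm.antidiagonal 3).over K)) ⧸
        ((glInt 3 K).map (MulAut.conj g₁).toMonoidHom).subgroupOf (unitaryGroupOfForm σ ((StdForm.antidiagonal 3).over K))) γ₄) : ℚ)) = (q : ℚ) * (-(q : ℚ)) ^ (n - 1) := by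
    rw [hV1, hV3, hV2, hV4, Nat.cast_one]
    have e : phiZero q (n - 1) 0 0 - phiOne q 0 (n - 1) = phiKappa q (n - 1) 0 0 := by rw [phiKappa]; ring
    rw [add_zero, hH0, mul_one] at h15
    linear_combination (q : ℚ) * e + (q : ℚ) * h15
  have keyC := congrArg (fun x : ℚ => (x : ℂ)) key
  push_cast at keyC
  -- `Φ = φ_H(q, 0) = 1`
  have hΦ := ncard_compression_fixed_eq_phiH hd h2 h2e ha hc (N := 0) (by rw [pow_zero, map_one]; exact hac) δ₁ hδ₁ x₀ hx₀ hloc hq1 hreg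
  rw [hH0] at hΦ
  have hΦC : (({v | HermitianLatticeTree.latticeTreeIso σ ϖ ((StdForm.antidiagonal 2).over K) δ₁ v = v}.ncard : ℕ) : ℂ) = 1 := by
    have h := congrArg (fun x : ℚ => (x : ℂ)) hΦ
    push_cast at h
    exact h
  -- `Δ = ((−q)ⁿ)⁻¹`: `|b − a| = |ϖⁿ|`, `|b − c| = 1`
  have hϖn : Valued.v (ϖ ^ n) < 1 := by
    rw [map_pow, hd.vϖ, ← WithZero.exp_nsmul, ← WithZero.exp_zero, WithZero.exp_lt_exp]; simp; omega
  have hvbc : Valued.v (b - c) = 1 := by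
    have e1 : b - c = (a - c) - (a - b) := by ring
    have hlt : Valued.v (a - b) < Valued.v (a - c) := by rw [hab, hac]; exact hϖn
    rw [e1, Valued.v.map_sub_eq_of_lt_left hlt, hac]
  have hΔ : (-(q : ℂ)) ^ WithZero.log (Valued.v ((b - a) * (b - c))) = ((-(q : ℂ)) ^ n)⁻¹ := by
    rw [map_mul, Valuation.map_sub_swap, hab, hvbc, mul_one, map_pow, hd.vϖ, ← WithZero.exp_nsmul, WithZero.log_exp, nsmul_eq_mul, mul_neg_one,
      zpow_neg, zpow_natCast]
  have hq0 : (-(q : ℂ)) ^ n ≠ 0 := pow_ne_zero _ (neg_ne_zero.2 (by exact_mod_cast (by omega : q ≠ 0)))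
  have hpow : (q : ℂ) * (-(q : ℂ)) ^ (n - 1) = -((-(q : ℂ)) ^ n) := by
    obtain ⟨k, rfl⟩ : ∃ k, n = k + 1 := ⟨n - 1, by omega⟩
    rw [Nat.add_sub_cancel, pow_succ]
    ring
  rw [hΔ, keyC, hΦC, hpow, mul_neg, inv_mul_cancel₀ hq0]
  norm_num

/-! ## §2 HEAD: (E1) for every `m` in regime `a ≡ b` -/

-- as above
set_option synthInstance.maxHeartbeats 400000 in
set_option maxHeartbeats 1600000 in
/-- **(E1) IN REGIME `a ≡ b`, EVERY `m`, UNCONDITIONALLY.**  Under typ1's (E1) v2.3 letters (`4c174fca74d7a58a` :191, all except the unused `hσe hab hbc hac`) and the regime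
letters `n ≥ 1`, `|a − b| = |ϖⁿ|`, `|a − c| = 1`: (E1)'s conclusion (BYTES VERBATIM) at displacement `m` — ★ FILE 3b `…_of_unitLevelOne` ∘ §1.
[cite: Rogawski1990, §4.9 Prop. 4.9.1 (b) pp. 54–55] [cite: Flicker1998UnitaryFL, §2 Prop. 3 pp. 78–79; §6 Theorem 15 pp. 95–96] [cite: Kottwitz1986BaseChangeUnits, §1 pp. 240–241]
[cite: LabesseLanglands1979, §§2–3] -/
theorem delta_mul_kappaSum_ncard_displaced_flicker_eq_sum_xiHCoeff_mul_ncard_displaced_two_of_congruent_ab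
    {K : Type} [Field K] [Valued K ℤᵐ⁰] [ValuativeRel K] [(Valued.v : Valuation K ℤᵐ⁰).Compatible]
    {σ : K →+* K} {ϖ : K} (hd : HermitianLattice.UnramifiedLocalConjDatum σ ϖ)
    (hσO : ∀ x : 𝒪[K], σ x ∈ 𝒪[K]) (σk : 𝓀[K] →+* 𝓀[K])
    (hσk : ∀ x : 𝒪[K], IsLocalRing.residue 𝒪[K] ⟨σ x, hσO x⟩ = σk (IsLocalRing.residue 𝒪[K] x))
    [Fintype 𝓀[K]] {q : ℕ} (hq : Fintype.card 𝓀[K] = q ^ 2) (hfrob : ∀ y, σk y = y ^ q)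
    (h2 : Valued.v (2 : K) = 1) {e : K} (h2e : 2 * e = 1)
    {a b c : K} (ha : σ a * a = 1) (hb : σ b * b = 1) (hc : σ c * c = 1)
    -- regime R-IIab: `a ≡ b` to depth `n ≥ 1`, `c` residually separated
    {n : ℕ} (hn : 1 ≤ n) (hab : Valued.v (a - b) = Valued.v (ϖ ^ n)) (hac : Valued.v (a - c) = 1)
    -- Flicker's four classes of the stable class of the `E¹`-type element with eigenvalues `(a, b, c)`, `b` on the `U(1)`-slot; κ-signs `(+,+,−,−)`
    (γ₁ γ₂ γ₃ γ₄ : unitaryGroupOfForm σ ((StdForm.antidiagonal 3).over K))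
    (hγ₁ : ((γ₁ : GL (Fin 3) K) : Matrix (Fin 3) (Fin 3) K) = !![e * (a + c), 0, -(e * (a - c)); 0, b, 0; -(e * (a - c)), 0, e * (a + c)])
    (hγ₂ : ((γ₂ : GL (Fin 3) K) : Matrix (Fin 3) (Fin 3) K) = !![e * (a + c), 0, -(e * (a - c) * ϖ); 0, b, 0; -(e * (a - c) * ϖ⁻¹), 0, e * (a + c)])
    (hγ₃ : ((γ₃ : GL (Fin 3) K) : Matrix (Fin 3) (Fin 3) K) = !![e * (a + b), 0, -(e * (a - b) * ϖ); 0, c, 0; -(e * (a - b) * ϖ⁻¹), 0, e * (a + b)])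
    (hγ₄ : ((γ₄ : GL (Fin 3) K) : Matrix (Fin 3) (Fin 3) K) = !![e * (b + c), 0, -(e * (b - c) * ϖ); 0, a, 0; -(e * (b - c) * ϖ⁻¹), 0, e * (b + c)])
    -- the two classes of the stable class of the `U(1,1)`-part of `γ_H = (δ, b)`: `δ_1`, `δ_ϖ`
    (δ₁ δ₂ : unitaryGroupOfForm σ ((StdForm.antidiagonal 2).over K))
    (hδ₁ : ((δ₁ : GL (Fin 2) K) : Matrix (Fin 2) (Fin 2) K) = !![e * (a + c), -(e * (a - c)); -(e * (a - c)), e * (a + c)])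
    (hδ₂ : ((δ₂ : GL (Fin 2) K) : Matrix (Fin 2) (Fin 2) K) = !![e * (a + c), -(e * (a - c) * ϖ); -(e * (a - c) * ϖ⁻¹), e * (a + c)])
    -- the ★ a₀ frame of typ1's (E1) v2.3 (completeness + FILE 0 (H.1)'s letters VERBATIM)
    [IsDiscreteValuationRing 𝒪[K]] [IsAdicComplete (IsLocalRing.maximalIdeal 𝒪[K]) 𝒪[K]]
    {y : K} (hy : y * σ y = -2)
    {cW : ↥(unitaryGroupOfForm σ ((StdForm.antidiagonal 3).over K))} (hcW : ((cW : GL (Fin 3) K) : Matrix (Fin 3) (Fin 3) K) = !![1, 0, 0; 0, -1, 0; 0, 0, 1])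
    (um : ℕ → ↥(unitaryGroupOfForm σ ((StdForm.antidiagonal 3).over K)))
    (hum : ∀ m, ((um m : GL (Fin 3) K) : Matrix (Fin 3) (Fin 3) K) = !![ϖ ^ m, y, (ϖ ^ m)⁻¹; 0, 1, -σ y * (ϖ ^ m)⁻¹; 0, 0, (ϖ ^ m)⁻¹])
    {R : Type} [CommRing R] [IsDomain R] [IsDiscreteValuationRing R] [Finite (IsLocalRing.ResidueField R)] [IsAdicComplete (IsLocalRing.maximalIdeal R) R]
    (ι : R →+* K) (hι : Function.Injective ι)
    (hιv : ∀ x : K, Valued.v x ≤ 1 ↔ x ∈ Set.range ι) (σR : R →+* R) (hσR : ∀ r, σR (σR r) = r) (hσι : ∀ r, ι (σR r) = σ (ι r))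
    {dR : R} (hdRσ : σR dR = -dR) (hdRu : IsUnit dR) (h2R : IsUnit (2 : R)) {ϖR : R} (hϖR : Irreducible ϖR) (hιϖ : ι ϖR = ϖ)
    (hqR : Nat.card (IsLocalRing.ResidueField R) = q ^ 2)
    {a₀ : 𝒪[K]} (ha₀ : IsUnit (((σ.comp 𝒪[K].subtype).codRestrict 𝒪[K] hσO) a₀ - a₀))
    (g₁ : GL (Fin 3) K) (hg₁ : (g₁ : Matrix (Fin 3) (Fin 3) K) = Matrix.diagonal ![(1 : K), 1, ϖ])
    (hfin₀₁ : (fixedBy (↥(unitaryGroupOfForm σ ((StdForm.antidiagonal 3).over K)) ⧸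
      (glInt 3 K).subgroupOf (unitaryGroupOfForm σ ((StdForm.antidiagonal 3).over K))) γ₁).Finite)
    (hfin₁₁ : (fixedBy (↥(unitaryGroupOfForm σ ((StdForm.antidiagonal 3).over K)) ⧸
      ((glInt 3 K).map (MulAut.conj g₁).toMonoidHom).subgroupOf (unitaryGroupOfForm σ ((StdForm.antidiagonal 3).over K))) γ₁).Finite)
    (horb₁ : (Set.range fun n : ℕ => ((γ₁ ^ n : ↥(unitaryGroupOfForm σ ((StdForm.antidiagonal 3).over K))) :
      ↥(unitaryGroupOfForm σ ((StdForm.antidiagonal 3).over K)) ⧸ (glInt 3 K).subgroupOf (unitaryGroupOfForm σ ((StdForm.antidiagonal 3).over K)))).Finite)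
    (hfin₀₂ : (fixedBy (↥(unitaryGroupOfForm σ ((StdForm.antidiagonal 3).over K)) ⧸
      (glInt 3 K).subgroupOf (unitaryGroupOfForm σ ((StdForm.antidiagonal 3).over K))) γ₂).Finite)
    (hfin₁₂ : (fixedBy (↥(unitaryGroupOfForm σ ((StdForm.antidiagonal 3).over K)) ⧸
      ((glInt 3 K).map (MulAut.conj g₁).toMonoidHom).subgroupOf (unitaryGroupOfForm σ ((StdForm.antidiagonal 3).over K))) γ₂).Finite)
    (horb₂ : (Set.range fun n : ℕ => ((γ₂ ^ n : ↥(unitaryGroupOfForm σ ((StdForm.antidiagonal 3).over K))) :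
      ↥(unitaryGroupOfForm σ ((StdForm.antidiagonal 3).over K)) ⧸ (glInt 3 K).subgroupOf (unitaryGroupOfForm σ ((StdForm.antidiagonal 3).over K)))).Finite)
    (hfin₀₃ : (fixedBy (↥(unitaryGroupOfForm σ ((StdForm.antidiagonal 3).over K)) ⧸
      (glInt 3 K).subgroupOf (unitaryGroupOfForm σ ((StdForm.antidiagonal 3).over K))) γ₃).Finite)
    (hfin₁₃ : (fixedBy (↥(unitaryGroupOfForm σ ((StdForm.antidiagonal 3).over K)) ⧸
      ((glInt 3 K).map (MulAut.conj g₁).toMonoidHom).subgroupOf (unitaryGroupOfForm σ ((StdForm.antidiagonal 3).over K))) γ₃).Finite)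
    (horb₃ : (Set.range fun n : ℕ => ((γ₃ ^ n : ↥(unitaryGroupOfForm σ ((StdForm.antidiagonal 3).over K))) :
      ↥(unitaryGroupOfForm σ ((StdForm.antidiagonal 3).over K)) ⧸ (glInt 3 K).subgroupOf (unitaryGroupOfForm σ ((StdForm.antidiagonal 3).over K)))).Finite)
    (hfin₀₄ : (fixedBy (↥(unitaryGroupOfForm σ ((StdForm.antidiagonal 3).over K)) ⧸
      (glInt 3 K).subgroupOf (unitaryGroupOfForm σ ((StdForm.antidiagonal 3).over K))) γ₄).Finite)
    (hfin₁₄ : (fixedBy (↥(unitaryGroupOfForm σ ((StdForm.antidiagonal 3).over K)) ⧸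
      ((glInt 3 K).map (MulAut.conj g₁).toMonoidHom).subgroupOf (unitaryGroupOfForm σ ((StdForm.antidiagonal 3).over K))) γ₄).Finite)
    (horb₄ : (Set.range fun n : ℕ => ((γ₄ ^ n : ↥(unitaryGroupOfForm σ ((StdForm.antidiagonal 3).over K))) :
      ↥(unitaryGroupOfForm σ ((StdForm.antidiagonal 3).over K)) ⧸ (glInt 3 K).subgroupOf (unitaryGroupOfForm σ ((StdForm.antidiagonal 3).over K)))).Finite)
    (x₀ : {M : Submodule (ValuativeRel.valuation K).integer (Fin 2 → K) // HermitianLatticeTree.IsSpecialLattice σ ϖ ((StdForm.antidiagonal 2).over K) M})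
    (hx₀ : x₀.1 = HermitianLatticeTree.latt (1 : Matrix (Fin 2) (Fin 2) K))
    (hloc : ∀ v, ((HermitianLatticeTree.latticeTree σ ϖ ((StdForm.antidiagonal 2).over K)).neighborSet v).Finite)
    (hreg : ∀ v, ((HermitianLatticeTree.latticeTree σ ϖ ((StdForm.antidiagonal 2).over K)).neighborSet v).ncard = q + 1)
    (m : ℕ) :
    (-(q : ℂ)) ^ WithZero.log (Valued.v ((b - a) * (b - c))) *
        (({x : {M : Submodule 𝒪[K] (Fin 3 → K) // UnitaryLatticeTree.IsVertex σ ϖ ((StdForm.antidiagonal 3).over K) M} |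
              UnitaryLatticeTree.IsSelfDualLattice σ ϖ ((StdForm.antidiagonal 3).over K) x.1 ∧
                (UnitaryLatticeTree.latticeGraph σ ϖ ((StdForm.antidiagonal 3).over K)).dist x
                  (UnitaryLatticeTree.latticeGraphPerm σ ϖ ((StdForm.antidiagonal 3).over K) γ₁ x) = 2 * m}.ncard : ℂ) +
          ({x : {M : Submodule 𝒪[K] (Fin 3 → K) // UnitaryLatticeTree.IsVertex σ ϖ ((StdForm.antidiagonal 3).over K) M} |
              UnitaryLatticeTree.IsSelfDualLattice σ ϖ ((StdForm.antidiagonal 3).over K) x.1 ∧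
                (UnitaryLatticeTree.latticeGraph σ ϖ ((StdForm.antidiagonal 3).over K)).dist x
                  (UnitaryLatticeTree.latticeGraphPerm σ ϖ ((StdForm.antidiagonal 3).over K) γ₂ x) = 2 * m}.ncard : ℂ) -
          ({x : {M : Submodule 𝒪[K] (Fin 3 → K) // UnitaryLatticeTree.IsVertex σ ϖ ((StdForm.antidiagonal 3).over K) M} |
              UnitaryLatticeTree.IsSelfDualLattice σ ϖ ((StdForm.antidiagonal 3).over K) x.1 ∧
                (UnitaryLatticeTree.latticeGraph σ ϖ ((StdForm.antidiagonal 3).over K)).dist x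
                  (UnitaryLatticeTree.latticeGraphPerm σ ϖ ((StdForm.antidiagonal 3).over K) γ₃ x) = 2 * m}.ncard : ℂ) -
          ({x : {M : Submodule 𝒪[K] (Fin 3 → K) // UnitaryLatticeTree.IsVertex σ ϖ ((StdForm.antidiagonal 3).over K) M} |
              UnitaryLatticeTree.IsSelfDualLattice σ ϖ ((StdForm.antidiagonal 3).over K) x.1 ∧
                (UnitaryLatticeTree.latticeGraph σ ϖ ((StdForm.antidiagonal 3).over K)).dist x
                  (UnitaryLatticeTree.latticeGraphPerm σ ϖ ((StdForm.antidiagonal 3).over K) γ₄ x) = 2 * m}.ncard : ℂ)) =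
      (∑ k ∈ Finset.range (m + 1), xiHCoeff q m k *
          ({x : {M : Submodule (ValuativeRel.valuation K).integer (Fin 2 → K) // HermitianLatticeTree.IsSpecialLattice σ ϖ ((StdForm.antidiagonal 2).over K) M} |
              HermitianLatticeTree.IsSelfDualLattice σ ((StdForm.antidiagonal 2).over K) x.1 ∧
                (HermitianLatticeTree.latticeTree σ ϖ ((StdForm.antidiagonal 2).over K)).dist x
                  (HermitianLatticeTree.latticeTreeIso σ ϖ ((StdForm.antidiagonal 2).over K) δ₁ x) = 2 * k}.ncard : ℂ)) +
        ∑ k ∈ Finset.range (m + 1), xiHCoeff q m k *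
          ({x : {M : Submodule (ValuativeRel.valuation K).integer (Fin 2 → K) // HermitianLatticeTree.IsSpecialLattice σ ϖ ((StdForm.antidiagonal 2).over K) M} |
              HermitianLatticeTree.IsSelfDualLattice σ ((StdForm.antidiagonal 2).over K) x.1 ∧
                (HermitianLatticeTree.latticeTree σ ϖ ((StdForm.antidiagonal 2).over K)).dist x
                  (HermitianLatticeTree.latticeTreeIso σ ϖ ((StdForm.antidiagonal 2).over K) δ₂ x) = 2 * k}.ncard : ℂ) := by
  -- the regime letters give pairwise distinct eigenvalues
  have hϖn : Valued.v (ϖ ^ n) < 1 := by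
    rw [map_pow, hd.vϖ, ← WithZero.exp_nsmul, ← WithZero.exp_zero, WithZero.exp_lt_exp]; simp; omega
  have hϖn0 : Valued.v (ϖ ^ n) ≠ 0 := (Valuation.ne_zero_iff _).2 (pow_ne_zero _ (CartanUnique.uniformizer_ne_zero hd.vϖ))
  have hab' : a ≠ b := fun h => hϖn0 (by rw [← hab, h, sub_self, map_zero])
  have hac' : a ≠ c := fun h => by rw [h, sub_self, map_zero] at hac; exact zero_ne_one hac
  have hbc' : b ≠ c := fun h => (ne_of_lt hϖn) (by rw [← hab, h, hac])
  exact delta_mul_kappaSum_ncard_displaced_flicker_eq_sum_xiHCoeff_mul_ncard_displaced_two_of_unitLevelOne hd hσO σk hσk hq hfrob h2 h2e ha hb hc hab' hbc' hac'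
    γ₁ γ₂ γ₃ γ₄ hγ₁ hγ₂ hγ₃ hγ₄ δ₁ δ₂ hδ₁ hδ₂ hy hcW um hum ι hι hιv σR hσR hσι hdRσ hdRu h2R hϖR hιϖ hqR ha₀ g₁ hg₁
    hfin₀₁ hfin₁₁ hfin₀₂ hfin₁₂ hfin₀₃ hfin₁₃ hfin₀₄ hfin₁₄ x₀ hx₀ hloc hreg
    (kappaSum_natCard_fixedBy_special_eq_of_congruent_ab hd hσO σk hσk hq hfrob h2 h2e ha hb hc hn hab hac γ₁ γ₂ γ₃ γ₄ hγ₁ hγ₂ hγ₃ hγ₄ δ₁ hδ₁ hy ha₀ g₁ hg₁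
      hfin₀₁ hfin₁₁ horb₁ hfin₀₂ hfin₁₂ horb₂ hfin₀₃ hfin₁₃ horb₃ hfin₀₄ hfin₁₄ horb₄ x₀ hx₀ hloc hreg) m

end CongruentAB

end Summit.HodgeConjecture.HodgeConjecture.R90.S6

end
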